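import Mathlib
import Summits.NavierStokesRegularity.NavierStokesRegularity.Theorems.EulerZoomLiouvillePowerGaugeEulerLiouvilleSeparablePast
import HarnessLib

/-!
# Crux `EulerZoomLiouville.PowerGaugeEulerLiouville` (stmt-NavierStokesRegularity-19832), stub `stub_nonSelfSimilarRest`:
# a steady field plus a PERSISTENTLY MODULATED fixed pattern, `u = U₀(x) + θ(τ) U₁(x)`, is trivial (the `E`-gauge)

Helper file (theorems only; `--supports stmt-NavierStokesRegularity-19832`; def-free).  Hand leafhand-ns-eulerzoomliouville-11 g0;
sequel to `…SeparablePast` (`U₀ = 0`) and to the `A`-gauge files `…SupercriticalModulationPast` / `…OscillatingModulationPast`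
(which need `θ` to GROW).  Here `θ` may be BOUNDED: its oscillation must not die out in Cesàro mean toward the past.
THE STRATUM: `u(τ, x) = U₀(x) + θ(τ) U₁(x)` for a.e. `(τ, x) ∈ (−∞, T₁) × ℝ³` (`T₁ ≤ 0`; `U₀, U₁` ARBITRARY; `θ` measurable) with
`∫_{I_b} ∫_{I_b} (θ(t) − θ(t'))² dt dt' ≥ κ b⁴` for large `b`, `I_b = (−b², T₁)`, some `κ > 0` (e.g. `θ = sin τ`, periodic or
almost-periodic non-constant `θ`, `sign(sin τ)`) ⇒ `u = 0` a.e., every `ρ > 0`: no member is a steady flow plus a fixed spatial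
pattern switched on and off persistently in the past.
PROOF: two good slices with `θ(τa) ≠ θ(τb)` give a weak gradient `G₁` of `U₁` and `H(t) − H(t') = (θ(t) − θ(t')) G₁` a.e.
(uniqueness); `|θ(t) − θ(t')|² |G₁|²_F ≤ 2(|H(t)|²_F + |H(t')|²_F)` integrated over `B_b × I_b²` (Tonelli) with the `E`-gauge gives
`κ b⁴ ∫_{B_b}|G₁|²_F ≤ 4 c b^{3−ρ}`, so `G₁ = 0`, `U₁ ≡ C₁` a.e.; if `C₁ ≠ 0` the two-slice `A`-gauge estimate forces `θ` constant on the
good past times (contradiction), so `u = U₀` a.e. and `AePastSteady` concludes.  WHAT THIS IS NOT: not the stub, not the crux,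
nothing about Navier–Stokes. [folklore]
-/

noncomputable section
-- flat `Theorems/<Route><Decl>…` files of one crux share the namespace of the crux (tree convention)
set_option linter.dupNamespace false

open MeasureTheory Set Filter Topology Metric Function TopologicalSpace
open scoped RealInnerProductSpace NNReal ENNReal

namespace Summit.NavierStokesRegularity.NavierStokesRegularity.Theorems.PowerGaugeEulerLiouville

open Literature.Analysis Literature.Analysis.FunctionSpaces Literature.Analysis.FluidPDE

namespace ModulatedPattern

/-- `|A − B|²_F ≤ 2 (|A|²_F + |B|²_F)` for the Frobenius norm. [folklore] -/
theorem frobeniusNormSq_sub_le (A B : EuclideanSpace ℝ (Fin 3) →L[ℝ] EuclideanSpace ℝ (Fin 3)) :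
    frobeniusNormSq (A - B) ≤ 2 * (frobeniusNormSq A + frobeniusNormSq B) := by
  rw [frobeniusNormSq_eq_sum (stdOrthonormalBasis ℝ (EuclideanSpace ℝ (Fin 3))),
    frobeniusNormSq_eq_sum (stdOrthonormalBasis ℝ (EuclideanSpace ℝ (Fin 3))),
    frobeniusNormSq_eq_sum (stdOrthonormalBasis ℝ (EuclideanSpace ℝ (Fin 3))),
    ← Finset.sum_add_distrib, Finset.mul_sum]
  refine Finset.sum_le_sum fun i _ => ?_
  have hAB : (A - B) (stdOrthonormalBasis ℝ (EuclideanSpace ℝ (Fin 3)) i) =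
      A (stdOrthonormalBasis ℝ (EuclideanSpace ℝ (Fin 3)) i) - B (stdOrthonormalBasis ℝ (EuclideanSpace ℝ (Fin 3)) i) := rfl
  rw [hAB]
  have h := norm_sub_le (A (stdOrthonormalBasis ℝ (EuclideanSpace ℝ (Fin 3)) i)) (B (stdOrthonormalBasis ℝ (EuclideanSpace ℝ (Fin 3)) i))
  nlinarith [norm_nonneg (A (stdOrthonormalBasis ℝ (EuclideanSpace ℝ (Fin 3)) i) - B (stdOrthonormalBasis ℝ (EuclideanSpace ℝ (Fin 3)) i)),
    norm_nonneg (A (stdOrthonormalBasis ℝ (EuclideanSpace ℝ (Fin 3)) i)), norm_nonneg (B (stdOrthonormalBasis ℝ (EuclideanSpace ℝ (Fin 3)) i)),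
    sq_nonneg (‖A (stdOrthonormalBasis ℝ (EuclideanSpace ℝ (Fin 3)) i)‖ - ‖B (stdOrthonormalBasis ℝ (EuclideanSpace ℝ (Fin 3)) i)‖)]

/-- Double-integral bookkeeping: `∫_I ∫_I 2 (e t + e t') dt' dt = 4 |I| ∫_I e`. [folklore] -/
theorem lintegral_lintegral_two_mul_add {I : Set ℝ} {e : ℝ → ℝ≥0∞} (he : AEMeasurable e (volume.restrict I)) :
    ∫⁻ t in I, ∫⁻ t' in I, 2 * (e t + e t') = 4 * volume I * ∫⁻ t in I, e t := by
  have h1 : ∀ t, ∫⁻ t' in I, 2 * (e t + e t') = 2 * (e t * volume I + ∫⁻ t' in I, e t') := by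
    intro t
    rw [lintegral_const_mul' _ _ (by norm_num), lintegral_add_right' _ he, setLIntegral_const]
  simp_rw [h1]
  rw [lintegral_const_mul' _ _ (by norm_num), lintegral_add_right _ measurable_const, setLIntegral_const,
    lintegral_mul_const'' _ he]
  ring

/-- **STEADY FIELD + PERSISTENTLY MODULATED PATTERN ⇒ TRIVIAL.**  Let `(u, p)` be a suitable weak Euler pair on `(−∞,0) × ℝ³` with
weak spatial gradient `H` and gauges `a^{2ρ} A(a) + a^{ρ} E(a) + a^{2ρ} D(a) ≤ c` (`ρ > 0`); suppose `u(τ, x) = U₀(x) + θ(τ) U₁(x)` for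
a.e. `(τ, x) ∈ (−∞, T₁) × ℝ³` (`T₁ ≤ 0`, `U₀ U₁` arbitrary, `θ` measurable) with
`∫_{(−b²,T₁)} ∫_{(−b²,T₁)} (θ(t) − θ(t'))² ≥ κ b⁴` for `b ≥ b₀`, some `κ > 0`.  Then `u = 0` a.e. on the slab. [folklore] -/
theorem ae_eq_zero_of_gauge_of_aeModulatedPattern {ρ : ℝ} (hρ : 0 < ρ)
    {u : ℝ → EuclideanSpace ℝ (Fin 3) → EuclideanSpace ℝ (Fin 3)} {p : ℝ → EuclideanSpace ℝ (Fin 3) → ℝ}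
    {H : ℝ → EuclideanSpace ℝ (Fin 3) → EuclideanSpace ℝ (Fin 3) →L[ℝ] EuclideanSpace ℝ (Fin 3)} {c : ℝ≥0}
    (hsw : IsSuitableWeakSolutionOn (slab (EuclideanSpace ℝ (Fin 3)) (Iio 0) isOpen_Iio) 0 0 u p)
    (hH : HasWeakSpatialGradientOn (slab (EuclideanSpace ℝ (Fin 3)) (Iio 0) isOpen_Iio) u H)
    (hc : ∀ a : ℝ, 0 < a → ENNReal.ofReal (a ^ (2 * ρ)) * cknA a (0 : ℝ × EuclideanSpace ℝ (Fin 3)) u +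
        ENNReal.ofReal (a ^ ρ) * cknE a (0 : ℝ × EuclideanSpace ℝ (Fin 3)) H +
        ENNReal.ofReal (a ^ (2 * ρ)) * cknD a (0 : ℝ × EuclideanSpace ℝ (Fin 3)) p ≤ (c : ℝ≥0∞))
    {T₁ : ℝ} (hT₁ : T₁ ≤ 0) {θ : ℝ → ℝ} (hθm : Measurable θ) {U₀ U₁ : EuclideanSpace ℝ (Fin 3) → EuclideanSpace ℝ (Fin 3)}
    (hθ : ∃ κ : ℝ, 0 < κ ∧ ∃ b₀ : ℝ, ∀ b : ℝ, b₀ ≤ b →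
      ENNReal.ofReal (κ * b ^ 4) ≤ ∫⁻ t in Ioo (-(b ^ 2)) T₁, ∫⁻ t' in Ioo (-(b ^ 2)) T₁, ‖θ t - θ t'‖ₑ ^ 2)
    (hU : ∀ᵐ z ∂(volume.restrict (Iio T₁ ×ˢ (univ : Set (EuclideanSpace ℝ (Fin 3))))),
      u z.1 z.2 = U₀ z.2 + θ z.1 • U₁ z.2) :
    uncurry u =ᵐ[volume.restrict (Iio (0 : ℝ) ×ˢ (univ : Set (EuclideanSpace ℝ (Fin 3))))] 0 := by
  obtain ⟨κ, hκ, b₀, hθ⟩ := hθ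
  have hE : ∀ a : ℝ, 0 < a →
      ENNReal.ofReal (a ^ ρ) * cknE a (0 : ℝ × EuclideanSpace ℝ (Fin 3)) H ≤ (c : ℝ≥0∞) :=
    fun a ha => le_trans (le_trans le_add_self le_self_add) (hc a ha)
  have hA : ∀ a : ℝ, 0 < a → ENNReal.ofReal (a ^ (2 * ρ)) *
      cknA a (0 : ℝ × EuclideanSpace ℝ (Fin 3)) u ≤ (c : ℝ≥0∞) :=
    fun a ha => le_trans (le_trans le_self_add le_self_add) (hc a ha)
  -- ## (1) good slices
  set Good : Set ℝ := {τ | HasWeakFDerivOn (⊤ : Opens (EuclideanSpace ℝ (Fin 3))) volume (u τ) (H τ) ∧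
    u τ =ᵐ[volume] fun x => U₀ x + θ τ • U₁ x} with hGood
  have hgood : ∀ᵐ τ ∂(volume.restrict (Iio T₁)), τ ∈ Good := by
    filter_upwards [FrameSteady.ae_hasWeakFDerivOn_slice_past hH hT₁,
      AffinePast.ae_ae_of_ae_slab (P := fun τ x => u τ x = U₀ x + θ τ • U₁ x) hU] with τ hτ hτ'
    exact ⟨hτ, hτ'⟩
  have hW : ∀ τ, τ ∈ Good →
      HasWeakFDerivOn (⊤ : Opens (EuclideanSpace ℝ (Fin 3))) volume (fun x => U₀ x + θ τ • U₁ x) (H τ) :=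
    fun τ hτ => SeparablePast.hasWeakFDerivOn_congr_ae hτ.1 hτ.2
  -- the oscillation integral vanishes if `θ` is constant on the good past times
  have hosc0 : ∀ s : ℝ, (∀ τ, τ ∈ Good → τ < T₁ → θ τ = s) → False := by
    intro s hs
    have hz : ∀ᵐ τ ∂(volume.restrict (Iio T₁)), θ τ = s := by
      filter_upwards [hgood, ae_restrict_mem measurableSet_Iio] with τ hτ hτT
      exact hs τ hτ hτT
    set b : ℝ := max b₀ 1 with hb
    have hb1 : 1 ≤ b := le_max_right _ _
    have hzI : ∀ᵐ t ∂(volume.restrict (Ioo (-(b ^ 2)) T₁)), θ t = s :=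
      ae_restrict_of_ae_restrict_of_subset (fun t ht => ht.2) hz
    have h0 : ∫⁻ t in Ioo (-(b ^ 2)) T₁, ∫⁻ t' in Ioo (-(b ^ 2)) T₁, ‖θ t - θ t'‖ₑ ^ 2 = 0 := by
      have hin : ∀ t, θ t = s → ∫⁻ t' in Ioo (-(b ^ 2)) T₁, ‖θ t - θ t'‖ₑ ^ 2 = 0 := by
        intro t ht
        refine (lintegral_eq_zero_iff' ((measurable_const.sub hθm).enorm.pow_const 2).aemeasurable).2 ?_
        filter_upwards [hzI] with t' ht'
        simp [ht, ht']
      refine (lintegral_eq_zero_iff' ?_).2 ?_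
      · exact (Measurable.lintegral_prod_right
          (f := fun t t' => ‖θ t - θ t'‖ₑ ^ 2)
          (((hθm.comp measurable_fst).sub (hθm.comp measurable_snd)).enorm.pow_const 2)).aemeasurable
      · filter_upwards [hzI] with t ht
        exact hin t ht
    have h2 := hθ b (le_max_left _ _)
    rw [h0, nonpos_iff_eq_zero, ENNReal.ofReal_eq_zero] at h2
    have : 0 < κ * b ^ 4 := by positivity
    linarith
  -- two good slices with different modulation values
  obtain ⟨τa, hτaT, hτaG, τb, hτbT, hτbG, hab⟩ :
      ∃ τa, τa < T₁ ∧ τa ∈ Good ∧ ∃ τb, τb < T₁ ∧ τb ∈ Good ∧ θ τa ≠ θ τb := by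
    by_contra hne
    push Not at hne
    -- then `θ` is constant on the good past times (vacuously fine if there are none)
    have hwin : volume (Ioo (T₁ - 1) T₁) ≠ 0 := by
      rw [Real.volume_Ioo]; exact (ENNReal.ofReal_pos.2 (by linarith)).ne'
    obtain ⟨τa, hτa, hτaG⟩ := Measure.exists_mem_of_measure_ne_zero_of_ae hwin
      (ae_restrict_of_ae_restrict_of_subset (fun τ hτ => hτ.2) hgood)
    exact hosc0 (θ τa) fun τ hτ hτT => (hne τa hτa.2 hτaG τ hτT hτ).symm
  have hab' : θ τb - θ τa ≠ 0 := sub_ne_zero.2 (Ne.symm hab)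
  -- ## the weak gradient `G₁` of `U₁`
  set G₁ : EuclideanSpace ℝ (Fin 3) → EuclideanSpace ℝ (Fin 3) →L[ℝ] EuclideanSpace ℝ (Fin 3) :=
    (θ τb - θ τa)⁻¹ • (H τb - H τa) with hG₁def
  have hGU₁ : HasWeakFDerivOn (⊤ : Opens (EuclideanSpace ℝ (Fin 3))) volume U₁ G₁ := by
    have h := ((hW τb hτbG).sub (hW τa hτaG)).const_smul (θ τb - θ τa)⁻¹
    have e : ((θ τb - θ τa)⁻¹ • ((fun x => U₀ x + θ τb • U₁ x) - fun x => U₀ x + θ τa • U₁ x)) = U₁ := by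
      funext x
      simp only [Pi.smul_apply, Pi.sub_apply]
      rw [add_sub_add_left_eq_sub, ← sub_smul, smul_smul, inv_mul_cancel₀ hab', one_smul]
    rwa [e] at h
  -- differences of good slices of `H` are `(θ t − θ t') G₁`
  have hslice : ∀ τ, τ ∈ Good → H τ =ᵐ[volume] fun y => H τa y - (θ τa - θ τ) • G₁ y := by
    intro τ hτ
    have h1 : HasWeakFDerivOn (⊤ : Opens (EuclideanSpace ℝ (Fin 3))) volume
        ((fun x => U₀ x + θ τa • U₁ x) - (θ τa - θ τ) • U₁) (H τa - (θ τa - θ τ) • G₁) :=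
      (hW τa hτaG).sub (hGU₁.const_smul (θ τa - θ τ))
    have e : ((fun x => U₀ x + θ τa • U₁ x) - (θ τa - θ τ) • U₁) = fun x => U₀ x + θ τ • U₁ x := by
      funext x
      simp only [Pi.sub_apply, Pi.smul_apply]
      rw [sub_smul]
      abel
    rw [e] at h1
    have h2 := HasWeakFDerivOn.unique_holds (hW τ hτ) h1
    rw [Opens.coe_top, Measure.restrict_univ] at h2
    filter_upwards [h2] with y hy
    rw [hy]
    rfl
  have hdiff : ∀ t t', t ∈ Good → t' ∈ Good → ∀ᵐ y ∂(volume : Measure (EuclideanSpace ℝ (Fin 3))),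
      H t y - H t' y = (θ t - θ t') • G₁ y := by
    intro t t' ht ht'
    filter_upwards [hslice t ht, hslice t' ht'] with y hy hy'
    rw [hy, hy']
    module
  -- ## (2) the `E`-gauge with the oscillation: `κ b⁴ ∫_{B_b}|G₁|²_F ≤ 4 c b^{3−ρ}`
  set F : ℝ × EuclideanSpace ℝ (Fin 3) → ℝ≥0∞ := fun q => ENNReal.ofReal (frobeniusNormSq (H q.1 q.2)) with hF
  set g : EuclideanSpace ℝ (Fin 3) → ℝ≥0∞ := fun y => ENNReal.ofReal (frobeniusNormSq (G₁ y)) with hg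
  have hFm : ∀ b : ℝ, AEMeasurable F
      ((volume.restrict (Ioo (-(b ^ 2)) T₁)).prod (volume.restrict (ball (0 : EuclideanSpace ℝ (Fin 3)) b))) := by
    intro b
    have hsub : Ioo (-(b ^ 2)) T₁ ×ˢ ball (0 : EuclideanSpace ℝ (Fin 3)) b ⊆
        ((slab (EuclideanSpace ℝ (Fin 3)) (Iio 0) isOpen_Iio : Opens _) : Set (ℝ × EuclideanSpace ℝ (Fin 3))) := by
      rw [coe_slab]
      exact prod_mono (fun t ht => lt_of_lt_of_le ht.2 hT₁) (subset_univ _)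
    have hsm : AEStronglyMeasurable (uncurry H)
        (volume.restrict (Ioo (-(b ^ 2)) T₁ ×ˢ ball (0 : EuclideanSpace ℝ (Fin 3)) b)) :=
      hH.locallyIntegrableOn_grad.aestronglyMeasurable.mono_measure (Measure.restrict_mono hsub le_rfl)
    rw [Measure.volume_eq_prod, ← Measure.prod_restrict] at hsm
    exact ((ENNReal.continuous_ofReal.comp continuous_frobeniusNormSq').comp_aestronglyMeasurable hsm).aemeasurable
  have hGsmall : ∀ b : ℝ, 0 < b → b₀ ≤ b →
      ENNReal.ofReal (κ * b ^ 4) * ∫⁻ y in ball (0 : EuclideanSpace ℝ (Fin 3)) b, g y ≤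
        4 * ENNReal.ofReal (b ^ 2) * ENNReal.ofReal ((c : ℝ) * b ^ (1 - ρ)) := by
    intro b hb hbb
    set I : Set ℝ := Ioo (-(b ^ 2)) T₁ with hI
    set e : ℝ → ℝ≥0∞ := fun t => ∫⁻ y in ball (0 : EuclideanSpace ℝ (Fin 3)) b, F (t, y) with he
    have hem : AEMeasurable e (volume.restrict I) := (hFm b).lintegral_prod_right'
    -- the window integral
    have hwinE : ∫⁻ t in I, e t ≤ ENNReal.ofReal ((c : ℝ) * b ^ (1 - ρ)) := by
      have hprod : (volume.restrict (I ×ˢ ball (0 : EuclideanSpace ℝ (Fin 3)) b) : Measure (ℝ × EuclideanSpace ℝ (Fin 3))) =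
          (volume.restrict I).prod (volume.restrict (ball (0 : EuclideanSpace ℝ (Fin 3)) b)) := by
        rw [Measure.volume_eq_prod, Measure.prod_restrict]
      have hton : ∫⁻ q in I ×ˢ ball (0 : EuclideanSpace ℝ (Fin 3)) b, F q = ∫⁻ t in I, e t := by
        rw [hprod]; exact lintegral_prod _ (hFm b)
      rw [← hton]
      exact (lintegral_mono_set (prod_mono (Ioo_subset_Ioo le_rfl hT₁) Subset.rfl)).trans
        (TimePeriodic.setLIntegral_window_le_of_gaugeE hb le_rfl le_rfl (hE b hb))
    -- pointwise-in-time estimate on good pairs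
    have hpair : ∀ t t', t ∈ Good → t' ∈ Good →
        ‖θ t - θ t'‖ₑ ^ 2 * ∫⁻ y in ball (0 : EuclideanSpace ℝ (Fin 3)) b, g y ≤ 2 * (e t + e t') := by
      intro t t' ht ht'
      have hmt : AEMeasurable (fun y => F (t, y)) (volume.restrict (ball (0 : EuclideanSpace ℝ (Fin 3)) b)) := by
        have h1 := ht.1.locallyIntegrableOn_deriv.aestronglyMeasurable
        rw [Opens.coe_top, Measure.restrict_univ] at h1
        exact ((ENNReal.continuous_ofReal.comp continuous_frobeniusNormSq').comp_aestronglyMeasurable h1.restrict).aemeasurable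
      rw [← lintegral_const_mul' _ _ (ENNReal.pow_ne_top enorm_ne_top), he]
      simp only
      rw [← lintegral_add_left' hmt, ← lintegral_const_mul' _ _ (by norm_num)]
      refine lintegral_mono_ae (ae_restrict_of_ae ?_)
      filter_upwards [hdiff t t' ht ht'] with y hy
      simp only [hF, hg]
      have hsub := frobeniusNormSq_sub_le (H t y) (H t' y)
      rw [hy, frobeniusNormSq_smul] at hsub
      calc ‖θ t - θ t'‖ₑ ^ 2 * ENNReal.ofReal (frobeniusNormSq (G₁ y))
          = ENNReal.ofReal ((θ t - θ t') ^ 2 * frobeniusNormSq (G₁ y)) := by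
            rw [Real.enorm_eq_ofReal_abs, ← ENNReal.ofReal_pow (abs_nonneg _), sq_abs, ← ENNReal.ofReal_mul (sq_nonneg _)]
        _ ≤ ENNReal.ofReal (2 * (frobeniusNormSq (H t y) + frobeniusNormSq (H t' y))) := ENNReal.ofReal_le_ofReal hsub
        _ = 2 * (ENNReal.ofReal (frobeniusNormSq (H t y)) + ENNReal.ofReal (frobeniusNormSq (H t' y))) := by
            rw [ENNReal.ofReal_mul (by norm_num), ENNReal.ofReal_ofNat,
              ENNReal.ofReal_add (frobeniusNormSq_nonneg _) (frobeniusNormSq_nonneg _)]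
    -- integrate over the good pairs
    have hdouble : ∫⁻ t in I, ∫⁻ t' in I, ‖θ t - θ t'‖ₑ ^ 2 * ∫⁻ y in ball (0 : EuclideanSpace ℝ (Fin 3)) b, g y ≤
        ∫⁻ t in I, ∫⁻ t' in I, 2 * (e t + e t') := by
      have hgI : ∀ᵐ t ∂(volume.restrict I), t ∈ Good := ae_restrict_of_ae_restrict_of_subset (fun t ht => ht.2) hgood
      refine lintegral_mono_ae ?_
      filter_upwards [hgI] with t ht
      refine lintegral_mono_ae ?_
      filter_upwards [hgI] with t' ht'
      exact hpair t t' ht ht'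
    have hlhs : ∫⁻ t in I, ∫⁻ t' in I, ‖θ t - θ t'‖ₑ ^ 2 * ∫⁻ y in ball (0 : EuclideanSpace ℝ (Fin 3)) b, g y =
        (∫⁻ t in I, ∫⁻ t' in I, ‖θ t - θ t'‖ₑ ^ 2) * ∫⁻ y in ball (0 : EuclideanSpace ℝ (Fin 3)) b, g y := by
      have h1 : ∀ t, ∫⁻ t' in I, ‖θ t - θ t'‖ₑ ^ 2 * ∫⁻ y in ball (0 : EuclideanSpace ℝ (Fin 3)) b, g y =
          (∫⁻ t' in I, ‖θ t - θ t'‖ₑ ^ 2) * ∫⁻ y in ball (0 : EuclideanSpace ℝ (Fin 3)) b, g y :=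
        fun t => lintegral_mul_const _ ((measurable_const.sub hθm).enorm.pow_const 2)
      simp_rw [h1]
      exact lintegral_mul_const _ (Measurable.lintegral_prod_right (f := fun t t' => ‖θ t - θ t'‖ₑ ^ 2)
        (((hθm.comp measurable_fst).sub (hθm.comp measurable_snd)).enorm.pow_const 2))
    have hvol : volume I ≤ ENNReal.ofReal (b ^ 2) := by
      rw [hI, Real.volume_Ioo]; exact ENNReal.ofReal_le_ofReal (by linarith)
    calc ENNReal.ofReal (κ * b ^ 4) * ∫⁻ y in ball (0 : EuclideanSpace ℝ (Fin 3)) b, g y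
        ≤ (∫⁻ t in I, ∫⁻ t' in I, ‖θ t - θ t'‖ₑ ^ 2) * ∫⁻ y in ball (0 : EuclideanSpace ℝ (Fin 3)) b, g y :=
          mul_le_mul' (hθ b hbb) le_rfl
      _ ≤ ∫⁻ t in I, ∫⁻ t' in I, 2 * (e t + e t') := by rw [← hlhs]; exact hdouble
      _ = 4 * volume I * ∫⁻ t in I, e t := lintegral_lintegral_two_mul_add hem
      _ ≤ 4 * ENNReal.ofReal (b ^ 2) * ENNReal.ofReal ((c : ℝ) * b ^ (1 - ρ)) := by gcongr
  -- ## hence `G₁ = 0` a.e. and `U₁` is a.e. a constant `C₁`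
  have hG₁meas : AEStronglyMeasurable G₁ volume := by
    have h := hGU₁.locallyIntegrableOn_deriv.aestronglyMeasurable
    rwa [Opens.coe_top, Measure.restrict_univ] at h
  have hlim : Tendsto (fun b : ℝ => ENNReal.ofReal (4 * (c : ℝ) / κ * b ^ (-(1 + ρ)))) atTop (𝓝 0) := by
    rw [show (0 : ℝ≥0∞) = ENNReal.ofReal (4 * (c : ℝ) / κ * 0) by simp]
    exact ENNReal.tendsto_ofReal ((tendsto_rpow_neg_atTop (by linarith)).const_mul _)
  have hball : ∀ r : ℝ, 0 < r → ∫⁻ y in ball (0 : EuclideanSpace ℝ (Fin 3)) r, g y = 0 := by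
    intro r hr
    refine nonpos_iff_eq_zero.1 (ge_of_tendsto hlim ?_)
    filter_upwards [eventually_ge_atTop r, eventually_ge_atTop b₀, eventually_gt_atTop 0] with b hbr hbb hb0
    have h1 := hGsmall b hb0 hbb
    have hYpos : 0 < κ * b ^ 4 := by positivity
    have hpos : ENNReal.ofReal (κ * b ^ 4) ≠ 0 := by rw [ENNReal.ofReal_ne_zero_iff]; exact hYpos
    have e4 : ENNReal.ofReal (4 * b ^ 2 * ((c : ℝ) * b ^ (1 - ρ))) =
        (4 : ℝ≥0∞) * ENNReal.ofReal (b ^ 2) * ENNReal.ofReal ((c : ℝ) * b ^ (1 - ρ)) := by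
      rw [ENNReal.ofReal_mul (p := 4 * b ^ 2) (by positivity), ENNReal.ofReal_mul (p := (4 : ℝ)) (q := b ^ 2) (by norm_num),
        ENNReal.ofReal_ofNat]
    rw [← e4] at h1
    have h2 : ∫⁻ y in ball (0 : EuclideanSpace ℝ (Fin 3)) b, g y ≤
        (ENNReal.ofReal (κ * b ^ 4))⁻¹ * ENNReal.ofReal (4 * b ^ 2 * ((c : ℝ) * b ^ (1 - ρ))) := by
      rw [← ENNReal.div_eq_inv_mul]
      exact ENNReal.le_div_iff_mul_le (Or.inl hpos) (Or.inl ENNReal.ofReal_ne_top) |>.2 (by rwa [mul_comm])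
    refine (lintegral_mono_set (ball_subset_ball hbr)).trans (h2.trans (le_of_eq ?_))
    rw [← ENNReal.ofReal_inv_of_pos hYpos, ← ENNReal.ofReal_mul (by positivity)]
    congr 1
    rw [show (-(1 + ρ) : ℝ) = (1 - ρ) - 2 by ring, Real.rpow_sub hb0 (1 - ρ) 2, Real.rpow_two]
    field_simp
  have hfrob0 : ∀ L : EuclideanSpace ℝ (Fin 3) →L[ℝ] EuclideanSpace ℝ (Fin 3), frobeniusNormSq L = 0 → L = 0 := by
    intro L h
    rw [frobeniusNormSq_eq_sum (stdOrthonormalBasis ℝ (EuclideanSpace ℝ (Fin 3)))] at h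
    have h0 : ∀ i, L (stdOrthonormalBasis ℝ (EuclideanSpace ℝ (Fin 3)) i) = 0 := by
      intro i
      have := (Finset.sum_eq_zero_iff_of_nonneg (fun j _ => sq_nonneg _)).1 h i (Finset.mem_univ _)
      exact norm_eq_zero.1 ((pow_eq_zero_iff two_ne_zero).1 this)
    ext1 x
    rw [← (stdOrthonormalBasis ℝ (EuclideanSpace ℝ (Fin 3))).sum_repr x, map_sum]
    simp [h0]
  have hG0 : G₁ =ᵐ[volume] 0 := by
    have hballae : ∀ n : ℕ, ∀ᵐ y ∂volume, y ∈ ball (0 : EuclideanSpace ℝ (Fin 3)) ((n : ℝ) + 1) → G₁ y = 0 := by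
      intro n
      have hmeas : AEMeasurable g (volume.restrict (ball (0 : EuclideanSpace ℝ (Fin 3)) ((n : ℝ) + 1))) :=
        ((ENNReal.continuous_ofReal.comp continuous_frobeniusNormSq').comp_aestronglyMeasurable
          hG₁meas.restrict).aemeasurable
      have h := (lintegral_eq_zero_iff' hmeas).1 (hball _ (by positivity))
      rw [Filter.EventuallyEq, ae_restrict_iff' measurableSet_ball] at h
      filter_upwards [h] with y hy hyb
      have h1 := hy hyb
      simp only [hg, Pi.zero_apply, ENNReal.ofReal_eq_zero] at h1
      exact hfrob0 _ (le_antisymm h1 (frobeniusNormSq_nonneg _))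
    filter_upwards [ae_all_iff.2 hballae] with y hy
    obtain ⟨n, hn⟩ := exists_nat_gt ‖y‖
    exact hy n (by rw [mem_ball_zero_iff]; linarith)
  have hW0 : HasWeakFDerivOn (⊤ : Opens (EuclideanSpace ℝ (Fin 3))) volume U₁ 0 :=
    { locallyIntegrableOn := hGU₁.locallyIntegrableOn
      locallyIntegrableOn_deriv :=
        (locallyIntegrable_const (0 : EuclideanSpace ℝ (Fin 3) →L[ℝ] EuclideanSpace ℝ (Fin 3))).locallyIntegrableOn _
      integral_fderiv_smul_eq := fun φ w hφ => by
        rw [hGU₁.integral_fderiv_smul_eq φ w hφ]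
        congr 1
        refine integral_congr_ae ?_
        filter_upwards [ae_restrict_of_ae hG0] with y hy
        rw [hy] }
  obtain ⟨C₁, hC₁⟩ := ae_eq_const_of_hasWeakFDerivOn_zero hW0
  -- ## (3) `C₁ = 0`: otherwise the `A`-gauge forces `θ` to be constant on the good past times
  have hC₁0 : C₁ = 0 := by
    by_contra hC₁ne
    refine hosc0 (θ τa) fun τ hτ hτT => ?_
    -- the two-slice estimate for the constant pattern `C₁` at the good times `τ`, `τa`
    have hmτ : AEStronglyMeasurable (fun x => U₀ x + θ τ • C₁) volume := by
      refine (hτ.1.locallyIntegrableOn.aestronglyMeasurable.mono_measure ?_).congr ?_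
      · rw [Opens.coe_top, Measure.restrict_univ]
      · filter_upwards [hτ.2, hC₁] with x hx hx'
        rw [hx, hx']
    set L₀ : ℝ := Real.sqrt (-τ) + Real.sqrt (-τa) + 1 with hL₀
    have hgrow : ∀ L : ℝ, L₀ ≤ L →
        ∫⁻ x in ball (0 : EuclideanSpace ℝ (Fin 3)) L, ‖(fun _ : EuclideanSpace ℝ (Fin 3) => (θ τ - θ τa) • C₁) x‖ₑ ^ 2 ≤
          (4 * (c : ℝ≥0∞)) * ENNReal.ofReal (L ^ (1 - 2 * ρ)) := by
      intro L hL
      have hs1 : 0 ≤ Real.sqrt (-τ) := Real.sqrt_nonneg _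
      have hs2 : 0 ≤ Real.sqrt (-τa) := Real.sqrt_nonneg _
      have hL0 : 0 < L := by linarith
      have hwin : ∀ σ : ℝ, σ < T₁ → Real.sqrt (-σ) + 1 ≤ L → σ ∈ Ioo (-(L ^ 2)) 0 := by
        intro σ hσ hσL
        refine ⟨?_, lt_of_lt_of_le hσ hT₁⟩
        have h1 : Real.sqrt (-σ) ^ 2 = -σ := Real.sq_sqrt (by linarith [lt_of_lt_of_le hσ hT₁])
        have h3 : Real.sqrt (-σ) ^ 2 < L ^ 2 := pow_lt_pow_left₀ (by linarith) (Real.sqrt_nonneg _) two_ne_zero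
        linarith
      have hb₁ : ∫⁻ x in ball (0 : EuclideanSpace ℝ (Fin 3)) L, ‖U₀ x + θ τa • C₁‖ₑ ^ 2 ≤
          ENNReal.ofReal ((c : ℝ) * L ^ (1 - 2 * ρ)) := by
        refine le_of_eq_of_le ?_ (Backward.lintegral_ball_le_of_gaugeA hL0 (hA L hL0) (hwin τa hτaT (by linarith)))
        refine lintegral_congr_ae (ae_restrict_of_ae ?_)
        filter_upwards [hτaG.2, hC₁] with x hx hx'
        rw [hx, hx']
      have hb₂ : ∫⁻ x in ball (0 : EuclideanSpace ℝ (Fin 3)) L, ‖U₀ x + θ τ • C₁‖ₑ ^ 2 ≤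
          ENNReal.ofReal ((c : ℝ) * L ^ (1 - 2 * ρ)) := by
        refine le_of_eq_of_le ?_ (Backward.lintegral_ball_le_of_gaugeA hL0 (hA L hL0) (hwin τ hτT (by linarith)))
        refine lintegral_congr_ae (ae_restrict_of_ae ?_)
        filter_upwards [hτ.2, hC₁] with x hx hx'
        rw [hx, hx']
      have hkey := AffinePast.lintegral_coeff_le_of_two_slices (U₀ := U₀) (U₁ := fun _ => C₁)
        (μ := volume.restrict (ball (0 : EuclideanSpace ℝ (Fin 3)) L)) hmτ.restrict hb₁ hb₂
      have e1 : ∫⁻ x in ball (0 : EuclideanSpace ℝ (Fin 3)) L, ‖(fun _ : EuclideanSpace ℝ (Fin 3) => (θ τ - θ τa) • C₁) x‖ₑ ^ 2 =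
          ‖θ τ - θ τa‖ₑ ^ 2 * ∫⁻ x in ball (0 : EuclideanSpace ℝ (Fin 3)) L, ‖(fun _ : EuclideanSpace ℝ (Fin 3) => C₁) x‖ₑ ^ 2 := by
        rw [← lintegral_const_mul' _ _ (ENNReal.pow_ne_top enorm_ne_top)]
        refine lintegral_congr fun x => ?_
        rw [enorm_smul, mul_pow]
      rw [e1]
      refine hkey.trans (le_of_eq ?_)
      rw [ENNReal.ofReal_mul c.coe_nonneg, ENNReal.ofReal_coe_nnreal, mul_assoc]
    have h4c : (4 * (c : ℝ≥0∞)) ≠ ⊤ := ENNReal.mul_ne_top (by norm_num) ENNReal.coe_ne_top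
    obtain ⟨C', hC', hCgrow⟩ := Shifted.growth_of_growth_le (V := fun _ : EuclideanSpace ℝ (Fin 3) => (θ τ - θ τa) • C₁)
      continuous_const (by linarith : 1 - 2 * ρ ≤ 3)
      (by linarith [Real.sqrt_nonneg (-τ), Real.sqrt_nonneg (-τa)] : 1 ≤ L₀) h4c hgrow
    have h0 := NoDrift.eq_zero_of_const_of_lintegral_ball_le hC' (by linarith) hCgrow
    rcases smul_eq_zero.1 h0 with h | h
    · exact sub_eq_zero.1 h
    · exact absurd h hC₁ne
  -- ## (4) `u = U₀` a.e. on the past slab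
  have hU' : ∀ᵐ z ∂(volume.restrict (Iio T₁ ×ˢ (univ : Set (EuclideanSpace ℝ (Fin 3))))), u z.1 z.2 = U₀ z.2 := by
    have h1 : ∀ᵐ x ∂(volume : Measure (EuclideanSpace ℝ (Fin 3))), U₁ x = 0 := by
      filter_upwards [hC₁] with x hx; rw [hx, hC₁0]
    filter_upwards [hU, AffinePast.ae_slab_of_ae (T₁ := T₁) h1] with z hz hz0
    rw [hz, hz0, smul_zero, add_zero]
  exact AePastSteady.ae_eq_zero_of_gauge_of_aePastSteady hρ hsw hH hc hT₁ hU'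

end ModulatedPattern

/-- **Binder language: STEADY FIELD + PERSISTENTLY MODULATED PATTERN ⇒ TRIVIAL** — `u(τ, x) = U₀(x) + θ(τ) U₁(x)` for a.e.
`(τ, x) ∈ (−∞,T₁) × ℝ³` (`T₁ ≤ 0`, `U₀ U₁` arbitrary, `θ` measurable) with persistent oscillation
`∫_{(−b²,T₁)}∫_{(−b²,T₁)} (θ(t) − θ(t'))² ≥ κ b⁴` for large `b`, some `κ > 0` (e.g. `θ = sin τ`, any periodic / almost-periodic
non-constant `θ`) ⇒ `u = 0` a.e., every `ρ > 0` (`ModulatedPattern.ae_eq_zero_of_gauge_of_aeModulatedPattern`). [folklore] -/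
theorem Birth.nonSelfSimilar_of_aeModulatedPattern :
    ∀ ρ : ℝ, 0 < ρ →
      ∀ (u : ℝ → EuclideanSpace ℝ (Fin 3) → EuclideanSpace ℝ (Fin 3)) (p : ℝ → EuclideanSpace ℝ (Fin 3) → ℝ)
        (H : ℝ → EuclideanSpace ℝ (Fin 3) → EuclideanSpace ℝ (Fin 3) →L[ℝ] EuclideanSpace ℝ (Fin 3)) (c : ℝ≥0),
        Birth.InClass ρ u p H c →
          (∃ T₁ : ℝ, T₁ ≤ 0 ∧ ∃ θ : ℝ → ℝ, ∃ U₀ U₁ : EuclideanSpace ℝ (Fin 3) → EuclideanSpace ℝ (Fin 3),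
              Measurable θ ∧
              (∃ κ : ℝ, 0 < κ ∧ ∃ b₀ : ℝ, ∀ b : ℝ, b₀ ≤ b →
                ENNReal.ofReal (κ * b ^ 4) ≤ ∫⁻ t in Ioo (-(b ^ 2)) T₁, ∫⁻ t' in Ioo (-(b ^ 2)) T₁, ‖θ t - θ t'‖ₑ ^ 2) ∧
              ∀ᵐ z ∂(volume.restrict (Iio T₁ ×ˢ (univ : Set (EuclideanSpace ℝ (Fin 3))))),
                u z.1 z.2 = U₀ z.2 + θ z.1 • U₁ z.2) →
          uncurry u =ᵐ[volume.restrict (Iio (0 : ℝ) ×ˢ (univ : Set (EuclideanSpace ℝ (Fin 3))))] 0 := by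
  intro ρ hρ u p H c hcl h
  obtain ⟨T₁, hT₁, θ, U₀, U₁, hθm, hθ, hU⟩ := h
  exact ModulatedPattern.ae_eq_zero_of_gauge_of_aeModulatedPattern hρ hcl.1 hcl.2.1 hcl.2.2 hT₁ hθm hθ hU

end Summit.NavierStokesRegularity.NavierStokesRegularity.Theorems.PowerGaugeEulerLiouville

end
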